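import Summits.CriticalPhenomena.PercolationContinuityZ3.Theorems.PercNearOneGluingNoHeavyLowerTailSpectatorExchangeRobust
import HarnessLib

/-!
# `NoHeavyLowerTail` (stmt-CriticalPhenomena-4575) — the spectator exchange FROM A QUESTION-9-TYPE BOUND: the socket through
# which a glued pre-FKG inequality (41) (Kozma–Nitzan Question 9 at three relays) feeds the formal-face atoms

Support file (lemma factory `prim-lf-3` gen 15; `--supports stmt-CriticalPhenomena-4575`).  No definitions, no named facts, no
sorries.  Memo: `run/shared/lean/prim/prim-lf-3/LF3-BETA-R.md` §18.

Setting of `spectatorExchange_robust`: finite weighted graph `w`, target `b`, pair `A = {p, p′}`, spectator `j`, vertex `z`,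
`U := {z↔p} ∪ {z↔p′} ∪ {z↔j}`, `E_z := {z ↮ b, p, p′, j}`, `a_v = P(v↔b)`,
`D := P(A↔b, E_z) − P(z↔b, A↮b, j↔A)`.  The face atoms of the `2 + (any law)` kernel need `a_w − a_z ≤ D` in the glued graph
`R = K_u/Y` (`w = j` in regime I, `w =` the weaker port in regime II) while the rankings are known before gluing (memo §16e,
§17e).  THIS FILE isolates the purely event-algebraic step of gen 13's proof as a socket:

* `spectatorExchange_of_isolationBound` — for ANY vertex `w` and either port `c ∈ A`: if
  `a_w ≤ P(z↔b, U) + P(c↔b, E_z)` then `a_w − a_z ≤ D` (two inclusions: `{c↔b} ∩ E_z ⊆ {A↔b} ∩ E_z` and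
  `{z↔b, A↮b, j↔A} ⊆ {z↔b} ∖ U`; no reliability hypothesis).
* `spectatorExchange_of_gluedQ9` — in particular, if `P(c↔b, U) ≤ P(z↔b, U)` (the pre-FKG inequality (41) at the observer `z`
  for the relay set `{p, p′, j}` and the designated relay `c`) then `a_c − a_z ≤ D`.
So: (i) wherever Kozma–Nitzan's Question 9 holds at `|A| = 3` for the glued observer `[Y]` with the port `p₁` designated in the
UNGLUED graph `K_u`, the regime-II atom (`faceII_atom`) needs no ranking in `K_u/Y` (memo §18b: with this row every flipped
regime-II atom has a linear certificate); (ii) the regime-I atoms beyond `spectatorExchange_atMostOneBelow` (the "hard core")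
follow from the isolation bound with `w = j`, i.e. from the conjectured quantitative form
`a_j ≤ P(z↔b, U) + P(c↔b, E_z)` (memo §18c, "CLUB"; census 0 / 4 700 atoms, adversarial climbs bottom out at 0).
[cite: KozmaNitzan2024, Question 9 and Question 7 (p. 36), Lemma 4 and (9) (pp. 9–10)]
-/

namespace Summit.CriticalPhenomena.PercolationContinuityZ3.Theorems

open MeasureTheory Set Literature.Probability.LatticeModels Literature.Probability.Percolation
open scoped Classical

noncomputable section

namespace UpsetExchange

universe u

variable {V : Type u} [Fintype V]

/-- **Spectator exchange from an isolation bound** (event algebra only): with `U = {z↔p} ∪ {z↔p′} ∪ {z↔j}`,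
`E_z = {z ↮ b,p,p′,j}` and `D` as in the module docstring, for every vertex `w` and the port `c = p`:
if `a_w ≤ P(z↔b, U) + P(p↔b, E_z)` then `a_w − a_z ≤ D`. [cite: KozmaNitzan2024, (9) (pp. 9–10), Question 9 (p. 36)] -/
theorem spectatorExchange_of_isolationBound (w : Sym2 V → unitInterval) (b z j p p' x : V)
    (h : (prodBernoulli w).real (openConn x b) ≤
      (prodBernoulli w).real (openConn z b ∩ (openConn z p' ∪ openConn z j ∪ openConn z p)) +
        (prodBernoulli w).real (openConn p b ∩ ((openConn z b)ᶜ ∩ (openConn z p)ᶜ ∩ (openConn z p')ᶜ ∩ (openConn z j)ᶜ))) :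
    (prodBernoulli w).real (openConn x b) - (prodBernoulli w).real (openConn z b) ≤
      (prodBernoulli w).real ((openConn p b ∪ openConn p' b) ∩ (openConn z b)ᶜ ∩ (openConn z p)ᶜ ∩
          (openConn z p')ᶜ ∩ (openConn z j)ᶜ) -
        (prodBernoulli w).real (openConn z b ∩ (openConn p b)ᶜ ∩ (openConn p' b)ᶜ ∩ (openConn j p ∪ openConn j p')) := by
  set μ := prodBernoulli w with hμ
  have hmeas : ∀ X : Set (BondConfig V), MeasurableSet X := fun _ => MeasurableSet.of_discrete
  set U : Set (BondConfig V) := openConn z p' ∪ openConn z j ∪ openConn z p with hU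
  -- split `a_z` along `U`
  have hsz := measureReal_inter_add_sdiff (μ := μ) (s := openConn z b) (hmeas U) (measure_ne_top _ _)
  -- `{p↔b} ∩ E_z ⊆ {A↔b} ∩ E_z`
  have h1 : μ.real (openConn p b ∩ ((openConn z b)ᶜ ∩ (openConn z p)ᶜ ∩ (openConn z p')ᶜ ∩ (openConn z j)ᶜ)) ≤
      μ.real ((openConn p b ∪ openConn p' b) ∩ (openConn z b)ᶜ ∩ (openConn z p)ᶜ ∩ (openConn z p')ᶜ ∩ (openConn z j)ᶜ) := by
    apply measureReal_mono
    · rintro ω ⟨hpbω, ⟨⟨⟨hzb, hzp⟩, hzp'⟩, hzj⟩⟩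
      exact ⟨⟨⟨⟨Or.inl hpbω, hzb⟩, hzp⟩, hzp'⟩, hzj⟩
    · exact measure_ne_top _ _
  -- `{z↔b, A↮b, j↔A} ⊆ {z↔b} \ U`
  have h2 : μ.real (openConn z b ∩ (openConn p b)ᶜ ∩ (openConn p' b)ᶜ ∩ (openConn j p ∪ openConn j p')) ≤
      μ.real (openConn z b \ U) := by
    apply measureReal_mono
    · rintro ω ⟨⟨⟨hzbω, hpbω⟩, hp'bω⟩, hjA⟩
      refine ⟨hzbω, ?_⟩
      simp only [hU, mem_union, not_or]
      refine ⟨⟨fun hzp' => hp'bω ?_, fun hzj => ?_⟩, fun hzp => hpbω ?_⟩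
      · exact (hzp' : (openGraph ω).Reachable z p').symm.trans (hzbω : (openGraph ω).Reachable z b)
      · rcases hjA with hjp | hjp'
        · exact hpbω (((hjp : (openGraph ω).Reachable j p).symm.trans
            (hzj : (openGraph ω).Reachable z j).symm).trans (hzbω : (openGraph ω).Reachable z b))
        · exact hp'bω (((hjp' : (openGraph ω).Reachable j p').symm.trans
            (hzj : (openGraph ω).Reachable z j).symm).trans (hzbω : (openGraph ω).Reachable z b))
      · exact (hzp : (openGraph ω).Reachable z p).symm.trans (hzbω : (openGraph ω).Reachable z b)
    · exact measure_ne_top _ _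
  linarith

/-- **Spectator exchange from an isolation bound**, second port: if `a_w ≤ P(z↔b, U) + P(p′↔b, E_z)` then `a_w − a_z ≤ D`.
[cite: KozmaNitzan2024, (9) (pp. 9–10), Question 9 (p. 36)] -/
theorem spectatorExchange_of_isolationBound' (w : Sym2 V → unitInterval) (b z j p p' x : V)
    (h : (prodBernoulli w).real (openConn x b) ≤
      (prodBernoulli w).real (openConn z b ∩ (openConn z p' ∪ openConn z j ∪ openConn z p)) +
        (prodBernoulli w).real (openConn p' b ∩ ((openConn z b)ᶜ ∩ (openConn z p)ᶜ ∩ (openConn z p')ᶜ ∩ (openConn z j)ᶜ))) :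
    (prodBernoulli w).real (openConn x b) - (prodBernoulli w).real (openConn z b) ≤
      (prodBernoulli w).real ((openConn p b ∪ openConn p' b) ∩ (openConn z b)ᶜ ∩ (openConn z p)ᶜ ∩
          (openConn z p')ᶜ ∩ (openConn z j)ᶜ) -
        (prodBernoulli w).real (openConn z b ∩ (openConn p b)ᶜ ∩ (openConn p' b)ᶜ ∩ (openConn j p ∪ openConn j p')) := by
  have hU : (openConn z p ∪ openConn z j ∪ openConn z p' : Set (BondConfig V)) = openConn z p' ∪ openConn z j ∪ openConn z p := by
    ext ω
    simp only [mem_union]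
    tauto
  have hE : ((openConn z b)ᶜ ∩ (openConn z p')ᶜ ∩ (openConn z p)ᶜ ∩ (openConn z j)ᶜ : Set (BondConfig V)) =
      (openConn z b)ᶜ ∩ (openConn z p)ᶜ ∩ (openConn z p')ᶜ ∩ (openConn z j)ᶜ := by
    ext ω
    simp only [mem_inter_iff, mem_compl_iff]
    tauto
  have h' : (prodBernoulli w).real (openConn x b) ≤
      (prodBernoulli w).real (openConn z b ∩ (openConn z p ∪ openConn z j ∪ openConn z p')) +
        (prodBernoulli w).real (openConn p' b ∩ ((openConn z b)ᶜ ∩ (openConn z p')ᶜ ∩ (openConn z p)ᶜ ∩ (openConn z j)ᶜ)) := by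
    rw [hU, hE]; exact h
  have key := spectatorExchange_of_isolationBound w b z j p' p x h'
  have hE1 : ((openConn p' b ∪ openConn p b) ∩ (openConn z b)ᶜ ∩ (openConn z p')ᶜ ∩ (openConn z p)ᶜ ∩
      (openConn z j)ᶜ : Set (BondConfig V)) =
      (openConn p b ∪ openConn p' b) ∩ (openConn z b)ᶜ ∩ (openConn z p)ᶜ ∩ (openConn z p')ᶜ ∩ (openConn z j)ᶜ := by
    ext ω
    simp only [mem_inter_iff, mem_union, mem_compl_iff]
    tauto
  have hE2 : (openConn z b ∩ (openConn p' b)ᶜ ∩ (openConn p b)ᶜ ∩ (openConn j p' ∪ openConn j p) :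
      Set (BondConfig V)) =
      openConn z b ∩ (openConn p b)ᶜ ∩ (openConn p' b)ᶜ ∩ (openConn j p ∪ openConn j p') := by
    ext ω
    simp only [mem_inter_iff, mem_union, mem_compl_iff]
    tauto
  rw [hE1, hE2] at key
  exact key

/-- **Spectator exchange from the glued pre-FKG inequality (41)**: if `P(p↔b, U) ≤ P(z↔b, U)` for
`U = {z↔p′} ∪ {z↔j} ∪ {z↔p}` — inequality (41) at the observer `z`, relays `{p′, j, p}`, designated relay `p` (Kozma–Nitzan
Question 7/9) — then `a_p − a_z ≤ D`, the conclusion of the regime-II face atom, with no ranking hypothesis.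
[cite: KozmaNitzan2024, Question 9 and Question 7 (p. 36), (41) (p. 36), (9) (pp. 9–10)] -/
theorem spectatorExchange_of_gluedQ9 (w : Sym2 V → unitInterval) (b z j p p' : V)
    (hq9 : (prodBernoulli w).real (openConn p b ∩ (openConn z p' ∪ openConn z j ∪ openConn z p)) ≤
      (prodBernoulli w).real (openConn z b ∩ (openConn z p' ∪ openConn z j ∪ openConn z p))) :
    (prodBernoulli w).real (openConn p b) - (prodBernoulli w).real (openConn z b) ≤
      (prodBernoulli w).real ((openConn p b ∪ openConn p' b) ∩ (openConn z b)ᶜ ∩ (openConn z p)ᶜ ∩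
          (openConn z p')ᶜ ∩ (openConn z j)ᶜ) -
        (prodBernoulli w).real (openConn z b ∩ (openConn p b)ᶜ ∩ (openConn p' b)ᶜ ∩ (openConn j p ∪ openConn j p')) := by
  set μ := prodBernoulli w with hμ
  have hmeas : ∀ X : Set (BondConfig V), MeasurableSet X := fun _ => MeasurableSet.of_discrete
  set U : Set (BondConfig V) := openConn z p' ∪ openConn z j ∪ openConn z p with hU
  have hsp := measureReal_inter_add_sdiff (μ := μ) (s := openConn p b) (hmeas U) (measure_ne_top _ _)
  -- off `U`, `{p↔b}` lies in `E_z` (since `z↔b` together with `p↔b` would give `z↔p ∈ U`)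
  have hoff : μ.real (openConn p b \ U) ≤
      μ.real (openConn p b ∩ ((openConn z b)ᶜ ∩ (openConn z p)ᶜ ∩ (openConn z p')ᶜ ∩ (openConn z j)ᶜ)) := by
    apply measureReal_mono
    · rintro ω ⟨hpbω, hUω⟩
      simp only [hU, mem_union, not_or] at hUω
      obtain ⟨⟨hzp', hzj⟩, hzp⟩ := hUω
      refine ⟨hpbω, ⟨⟨⟨fun hzbω => hzp ?_, hzp⟩, hzp'⟩, hzj⟩⟩
      exact (hzbω : (openGraph ω).Reachable z b).trans (hpbω : (openGraph ω).Reachable p b).symm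
    · exact measure_ne_top _ _
  exact spectatorExchange_of_isolationBound w b z j p p' p (by linarith)

end UpsetExchange

end

end Summit.CriticalPhenomena.PercolationContinuityZ3.Theorems
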